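import Summits.Ventures.WeilGRH.TwistedPrimeFormBound
import Summits.RiemannHypothesis.RiemannHypothesis.Theorems.WeilFormatCFarAssembly
import HarnessLib

/-!
# GRH arm (rh-explicit, venture WeilGRH): L-C3a for a character — the sector kernels of `twistedGramCoeff χ a` are
  `⪰ diag(d̂^±_χ)` on EVERY far truncation (hypotheses `hfar_e` / `hfar_o` of the twisted format-C doors)

Cell `rh-explicit`, WEIL TRACK — GRH ARM (lit/typing seat weil-grh-5 gen11).  Twisted analogue of weil-10's
`WeilFormatCFarAssembly.lean` / weil-1's `WeilFormatCFarAssemblyA.lean` (FORMATC-DESIGN §4.3/§9.4): the far-diagonal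
lower bounds a format-C certificate needs for the kernel `G = twistedGramCoeff χ a` of
`TwistedGramEvenReal.lean` (the Gram matrix of a REAL character of either parity on Yoshida's basis; doors
`weilPositivityOnChar_of_formatC_certificates` / `…_real`, weil-grh-1).  By
`twistedGramCoeff_eq_arch_add_prime_add_conductor` the kernel is Yoshida's ARCHIMEDEAN kernel (weil-10's far bounds
`evenArch_far_ge_diag` / `oddArch_far_ge_diag[_atan]` apply verbatim), plus the TWISTED PRIME kernel
(`⪰ −A·1` for any certified constant `A`, e.g. `A = A_op⁺(a)` by `twistedPrime_form_ge_char` — the same path-graph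
constant as `ζ`), plus `(log q)δ` (`⪰ (log q)·1`), and NO pole term.  Hence, in M-units
(`E = weilArchDensity(2a)`, `c_R = a(1+E)/π²`, `ω_n = πn/a`):

* `twistedGramCoeff_even_far_ge_diag_A` / `twistedGramCoeff_even_far_ge_diag` — for `2 ≤ B` and all `N, y`:
  `Σ_{n∈Ico B N} d̂⁺_χ(n) y_n² ≤ Σ_{n,m∈Ico B N} y_n M⁺(n,m) y_m`,
  `d̂⁺_χ(n) = ½(Re ψ(¼+iω_n/2) − log π + log q) − c_R/n² − 1/(8n) − c_R√(8/(B−1)) − A/2`;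
* `twistedGramCoeff_odd_far_ge_diag_A` / `…_odd_far_ge_diag` (log Hilbert weight) and `…_atan_A` / `…_atan` — for
  `1 ≤ B` and all `N, z` (kernel index `k` = mode `k+1`):
  `d̂⁻_χ(k) = ½(Re ψ(¼+iω_{k+1}/2) − log π + log q) − 1/(8(k+1)) − c_R/(k+1)² − h(k) − c_R√(8/B) − A/2`,
  `h(k) = ¼log((k+1+B)/B)` or `½(π/2 − arctan(√B/√(k+1)))`

— i.e. the `ζ` far diagonals with the pole penalty `s²a/(π²B)` REMOVED and `(log q)/2` ADDED.  For odd χ the true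
kernel `twistedGramCoeffOdd` exceeds `twistedGramCoeff` by the (PSD) parity bonus, which the doors
`…_sector_psd_odd` / `…_formatC_certificates_real` already drop; the digamma here stays `Re ψ(¼ + ·)`.
What a χ-rung still has to supply per sector: `0 < d̂` on `m ≥ B`, the coupling majorant `hU` (L-C3b: exact columns +
tail, the twisted analogue of `WeilFormatCColumnEven/Odd` + `TailEven/Odd` — NOT in this file) and the kernel certificate
`hS`.  No definitions; no named facts; RH/GRH-free; standard axioms.
-/

set_option autoImplicit false

noncomputable section

open Complex Finset
open scoped Real BigOperators ComplexConjugate ArithmeticFunction.vonMangoldt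

namespace Summit.Ventures.WeilGRH

open Literature.NumberTheory.LFunctions
open Literature.NumberTheory.LFunctions.Yoshida1992 (modes chi freq gramCoeff polarCoeff incrCoeff primeCoeff
  archCoeff)
open Literature.Analysis.SpecialFunctions
open Summit.RiemannHypothesis.RiemannHypothesis.Theorems.WeilFormatC

variable {q : ℕ} {a : ℝ}

/-! ## The conductor block `(log q)δ` -/

/-- The diagonal kernel `L·δ` as a quadratic form: `Σ_{p,p'∈s} x_p x_{p'} L δ_{pp'} = L Σ_{p∈s} x_p²`. -/
theorem conductor_form_eq (L : ℝ) (s : Finset ℤ) (x : ℤ → ℝ) :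
    ∑ p ∈ s, ∑ p' ∈ s, x p * x p' * (if p = p' then L else 0) = L * ∑ p ∈ s, x p ^ 2 := by
  rw [Finset.mul_sum]
  refine Finset.sum_congr rfl fun p hp ↦ ?_
  rw [Finset.sum_eq_single_of_mem p hp (fun p' _ hp' ↦ by rw [if_neg (Ne.symm hp'), mul_zero])]
  rw [if_pos rfl]; ring

/-- Real-coefficient form of a certified twisted prime constant. -/
theorem twistedPrime_form_ge_real_of (χ : DirichletCharacter ℂ q) {A : ℝ}
    (hPA : ∀ (s : Finset ℤ) (c : ℤ → ℂ),
      -(A * ∑ n ∈ s, ‖c n‖ ^ 2) ≤ ∑ n ∈ s, ∑ m ∈ s, (conj (c n) * c m).re *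
        ∑ k ∈ weilPrimeIndex a, (χ (k : ZMod q)).re * ((Λ k : ℝ) / Real.sqrt k) *
          (incrCoeff a (Real.log k) n m - if n = m then 2 else 0))
    (s : Finset ℤ) (x : ℤ → ℝ) :
    -(A * ∑ n ∈ s, x n ^ 2) ≤ ∑ n ∈ s, ∑ m ∈ s, x n * x m *
        ∑ k ∈ weilPrimeIndex a, (χ (k : ZMod q)).re * ((Λ k : ℝ) / Real.sqrt k) *
          (incrCoeff a (Real.log k) n m - if n = m then 2 else 0) := by
  have h := hPA s (fun n ↦ ((x n : ℝ) : ℂ))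
  have e1 : ∑ n ∈ s, ‖((x n : ℝ) : ℂ)‖ ^ 2 = ∑ n ∈ s, x n ^ 2 :=
    Finset.sum_congr rfl fun n _ ↦ by rw [Complex.norm_real, Real.norm_eq_abs, sq_abs]
  have e2 : ∀ K : ℤ → ℤ → ℝ, ∑ n ∈ s, ∑ m ∈ s, (conj ((x n : ℝ) : ℂ) * ((x m : ℝ) : ℂ)).re * K n m
      = ∑ n ∈ s, ∑ m ∈ s, x n * x m * K n m := fun K ↦
    Finset.sum_congr rfl fun n _ ↦ Finset.sum_congr rfl fun m _ ↦ by
      rw [Complex.conj_ofReal, ← Complex.ofReal_mul, Complex.ofReal_re]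
  rw [e1, e2] at h
  exact h

/-! ## The far diagonal bounds for `twistedGramCoeff χ a` with a certified prime constant `A` -/

section Far

/-- **L-C3a for a character, even sector, certified prime constant `A`.**  For `a > 0`, `hPA`, `2 ≤ B` and every
`N`, `y`: `Σ_{n∈Ico B N} d̂⁺_χ(n) y_n² ≤ Σ_{n,m∈Ico B N} y_n M⁺_{twistedGramCoeff χ a}(n,m) y_m` (module docstring). -/
theorem twistedGramCoeff_even_far_ge_diag_A (χ : DirichletCharacter ℂ q) (ha : 0 < a) {A : ℝ}
    (hPA : ∀ (s : Finset ℤ) (c : ℤ → ℂ),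
      -(A * ∑ n ∈ s, ‖c n‖ ^ 2) ≤ ∑ n ∈ s, ∑ m ∈ s, (conj (c n) * c m).re *
        ∑ k ∈ weilPrimeIndex a, (χ (k : ZMod q)).re * ((Λ k : ℝ) / Real.sqrt k) *
          (incrCoeff a (Real.log k) n m - if n = m then 2 else 0))
    {B : ℕ} (hB : 2 ≤ B) (N : ℕ) (y : ℕ → ℝ) :
    ∑ n ∈ Finset.Ico B N,
        ((reDigammaQuarter (freq a n) - Real.log π + Real.log q) / 2
          - a * (1 + weilArchDensity (2 * a)) / (π ^ 2 * n ^ 2)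
          - 1 / (8 * n) - a * (1 + weilArchDensity (2 * a)) / π ^ 2 * Real.sqrt (8 / ((B - 1 : ℕ) : ℝ))
          - A / 2)
          * y n ^ 2
      ≤ ∑ n ∈ Finset.Ico B N, ∑ m ∈ Finset.Ico B N,
          y n * (if n = 0 then twistedGramCoeff χ a 0 m else if m = 0 then twistedGramCoeff χ a n 0
            else (twistedGramCoeff χ a n m + twistedGramCoeff χ a n (-(m : ℤ))) / 2) * y m := by
  have hB1 : 1 ≤ B := le_trans (by norm_num) hB
  have hs1 : ∀ n ∈ Finset.Ico B N, 1 ≤ n := fun n hn ↦ le_trans hB1 (Finset.mem_Ico.mp hn).1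
  -- the three kernels
  set T : ℤ → ℤ → ℝ := fun n m ↦ ∑ k ∈ weilPrimeIndex a, (χ (k : ZMod q)).re * ((Λ k : ℝ) / Real.sqrt k) *
    (incrCoeff a (Real.log k) n m - if n = m then 2 else 0) with hT
  set D : ℤ → ℤ → ℝ := fun n m ↦ if n = m then Real.log q else 0 with hD
  have hTrefl : ∀ n m, T (-n) (-m) = T n m := fun n m ↦ twistedPrime_neg_neg _ a n m
  have hDrefl : ∀ n m, D (-n) (-m) = D n m := fun n m ↦ by simp only [hD, neg_inj]
  have htG : ∀ n m : ℤ, twistedGramCoeff χ a n m = archCoeff a n m + T n m + D n m := fun n m ↦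
    twistedGramCoeff_eq_arch_add_prime_add_conductor χ a n m
  -- split the kernel
  have hsplit : ∀ n ∈ Finset.Ico B N, ∀ m ∈ Finset.Ico B N,
      y n * (if n = 0 then twistedGramCoeff χ a 0 m else if m = 0 then twistedGramCoeff χ a n 0
            else (twistedGramCoeff χ a n m + twistedGramCoeff χ a n (-(m : ℤ))) / 2) * y m
        = y n * (if n = 0 then T 0 m else if m = 0 then T n 0 else (T n m + T n (-(m : ℤ))) / 2) * y m
          + y n * (if n = 0 then D 0 m else if m = 0 then D n 0 else (D n m + D n (-(m : ℤ))) / 2) * y m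
          + y n * ((archCoeff a n m + archCoeff a n (-(m : ℤ))) / 2) * y m := by
    intro n hn m hm
    rw [evenKernel_of_pos _ (hs1 n hn) (hs1 m hm), evenKernel_of_pos _ (hs1 n hn) (hs1 m hm),
      evenKernel_of_pos _ (hs1 n hn) (hs1 m hm), htG, htG]
    ring
  have hform : ∑ n ∈ Finset.Ico B N, ∑ m ∈ Finset.Ico B N,
      y n * (if n = 0 then twistedGramCoeff χ a 0 m else if m = 0 then twistedGramCoeff χ a n 0
            else (twistedGramCoeff χ a n m + twistedGramCoeff χ a n (-(m : ℤ))) / 2) * y m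
      = (∑ n ∈ Finset.Ico B N, ∑ m ∈ Finset.Ico B N,
          y n * (if n = 0 then T 0 m else if m = 0 then T n 0 else (T n m + T n (-(m : ℤ))) / 2) * y m)
        + (∑ n ∈ Finset.Ico B N, ∑ m ∈ Finset.Ico B N,
          y n * (if n = 0 then D 0 m else if m = 0 then D n 0 else (D n m + D n (-(m : ℤ))) / 2) * y m)
        + ∑ n ∈ Finset.Ico B N, ∑ m ∈ Finset.Ico B N,
          y n * ((archCoeff a n m + archCoeff a n (-(m : ℤ))) / 2) * y m := by
    rw [← Finset.sum_add_distrib, ← Finset.sum_add_distrib]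
    refine Finset.sum_congr rfl fun n hn ↦ ?_
    rw [← Finset.sum_add_distrib, ← Finset.sum_add_distrib]
    exact Finset.sum_congr rfl fun m hm ↦ hsplit n hn m hm
  -- TWISTED PRIME ⪰ −A/2
  have hpri := even_far_lower_const_of_modes T hTrefl hB1 (N := N) (-A)
    (fun x _ _ ↦ by
      have h := twistedPrime_form_ge_real_of χ hPA (modes N) x
      linarith) y
  -- CONDUCTOR ⪰ (log q)/2
  have hcond := even_far_lower_const_of_modes D hDrefl hB1 (N := N) (Real.log q)
    (fun x _ _ ↦ by rw [conductor_form_eq]) y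
  -- ARCH ⪰ diag(e⁺) with M₁ = B − 1
  have harch := evenArch_far_ge_diag ha (M₁ := B - 1) (by omega) (N - 1) y
  rw [← Ico_eq_Ioc_pred hB1 N] at harch
  -- assemble
  rw [hform]
  have hlhs : ∑ n ∈ Finset.Ico B N,
      ((reDigammaQuarter (freq a n) - Real.log π + Real.log q) / 2
        - a * (1 + weilArchDensity (2 * a)) / (π ^ 2 * n ^ 2)
        - 1 / (8 * n) - a * (1 + weilArchDensity (2 * a)) / π ^ 2 * Real.sqrt (8 / ((B - 1 : ℕ) : ℝ))
        - A / 2) * y n ^ 2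
      = (-A) / 2 * ∑ n ∈ Finset.Ico B N, y n ^ 2 + Real.log q / 2 * ∑ n ∈ Finset.Ico B N, y n ^ 2
        + ∑ n ∈ Finset.Ico B N,
          ((reDigammaQuarter (freq a n) - Real.log π) / 2 - a * (1 + weilArchDensity (2 * a)) / (π ^ 2 * n ^ 2)
            - 1 / (8 * n) - a * (1 + weilArchDensity (2 * a)) / π ^ 2 * Real.sqrt (8 / ((B - 1 : ℕ) : ℝ)))
            * y n ^ 2 := by
    rw [Finset.mul_sum, Finset.mul_sum, ← Finset.sum_add_distrib, ← Finset.sum_add_distrib]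
    refine Finset.sum_congr rfl fun n _ ↦ by ring
  rw [hlhs]
  exact add_le_add (add_le_add hpri hcond) harch

/-- The odd sector, NON-archimedean part: the twisted prime kernel and the conductor give
`(−A/2 + (log q)/2)·Σ z_k² ≤ Σ_{k,l} z_k [M⁻_{tG} − M⁻_{arch}](k,l) z_l` on every `Ico B N`. -/
theorem twistedGramCoeff_odd_nonarch_far_ge (χ : DirichletCharacter ℂ q) {A : ℝ}
    (hPA : ∀ (s : Finset ℤ) (c : ℤ → ℂ),
      -(A * ∑ n ∈ s, ‖c n‖ ^ 2) ≤ ∑ n ∈ s, ∑ m ∈ s, (conj (c n) * c m).re *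
        ∑ k ∈ weilPrimeIndex a, (χ (k : ZMod q)).re * ((Λ k : ℝ) / Real.sqrt k) *
          (incrCoeff a (Real.log k) n m - if n = m then 2 else 0))
    (B N : ℕ) (z : ℕ → ℝ) :
    (-A) / 2 * ∑ k ∈ Finset.Ico B N, z k ^ 2 + Real.log q / 2 * ∑ k ∈ Finset.Ico B N, z k ^ 2
      ≤ ∑ k ∈ Finset.Ico B N, ∑ l ∈ Finset.Ico B N,
          z k * ((twistedGramCoeff χ a ((k : ℤ) + 1) ((l : ℤ) + 1) -
            twistedGramCoeff χ a ((k : ℤ) + 1) (-((l : ℤ) + 1))) / 2) * z l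
        - ∑ k ∈ Finset.Ico B N, ∑ l ∈ Finset.Ico B N,
          z k * ((archCoeff a ((k : ℤ) + 1) ((l : ℤ) + 1) - archCoeff a ((k : ℤ) + 1) (-((l : ℤ) + 1))) / 2)
            * z l := by
  set T : ℤ → ℤ → ℝ := fun n m ↦ ∑ k ∈ weilPrimeIndex a, (χ (k : ZMod q)).re * ((Λ k : ℝ) / Real.sqrt k) *
    (incrCoeff a (Real.log k) n m - if n = m then 2 else 0) with hT
  set D : ℤ → ℤ → ℝ := fun n m ↦ if n = m then Real.log q else 0 with hD
  have hTrefl : ∀ n m, T (-n) (-m) = T n m := fun n m ↦ twistedPrime_neg_neg _ a n m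
  have hDrefl : ∀ n m, D (-n) (-m) = D n m := fun n m ↦ by simp only [hD, neg_inj]
  have htG : ∀ n m : ℤ, twistedGramCoeff χ a n m = archCoeff a n m + T n m + D n m := fun n m ↦
    twistedGramCoeff_eq_arch_add_prime_add_conductor χ a n m
  -- split the kernel
  have hform : ∑ k ∈ Finset.Ico B N, ∑ l ∈ Finset.Ico B N,
      z k * ((twistedGramCoeff χ a ((k : ℤ) + 1) ((l : ℤ) + 1) -
        twistedGramCoeff χ a ((k : ℤ) + 1) (-((l : ℤ) + 1))) / 2) * z l
        - ∑ k ∈ Finset.Ico B N, ∑ l ∈ Finset.Ico B N,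
          z k * ((archCoeff a ((k : ℤ) + 1) ((l : ℤ) + 1) - archCoeff a ((k : ℤ) + 1) (-((l : ℤ) + 1))) / 2)
            * z l
      = (∑ k ∈ Finset.Ico B N, ∑ l ∈ Finset.Ico B N,
          z k * ((T ((k : ℤ) + 1) ((l : ℤ) + 1) - T ((k : ℤ) + 1) (-((l : ℤ) + 1))) / 2) * z l)
        + (∑ k ∈ Finset.Ico B N, ∑ l ∈ Finset.Ico B N,
          z k * ((D ((k : ℤ) + 1) ((l : ℤ) + 1) - D ((k : ℤ) + 1) (-((l : ℤ) + 1))) / 2) * z l) := by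
    rw [sub_eq_iff_eq_add, ← Finset.sum_add_distrib, ← Finset.sum_add_distrib]
    refine Finset.sum_congr rfl fun k _ ↦ ?_
    rw [← Finset.sum_add_distrib, ← Finset.sum_add_distrib]
    refine Finset.sum_congr rfl fun l _ ↦ ?_
    rw [htG, htG]
    ring
  -- TWISTED PRIME ⪰ −A/2
  have hpri := odd_far_lower_const_of_modes T hTrefl (B := B) (N := N) (-A)
    (fun x _ _ ↦ by
      have h := twistedPrime_form_ge_real_of χ hPA (modes N) x
      linarith) z
  -- CONDUCTOR ⪰ (log q)/2
  have hcond := odd_far_lower_const_of_modes D hDrefl (B := B) (N := N) (Real.log q)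
    (fun x _ _ ↦ by rw [conductor_form_eq]) z
  rw [hform]
  exact add_le_add hpri hcond

/-- **L-C3a for a character, odd sector, certified prime constant `A`** (log Hilbert weight).  For `a > 0`, `hPA`,
`1 ≤ B` and every `N`, `z` (kernel index `k` = mode `k+1`):
`Σ_{k∈Ico B N} d̂⁻_χ(k) z_k² ≤ Σ_{k,l∈Ico B N} z_k M⁻_{twistedGramCoeff χ a}(k,l) z_l` (module docstring). -/
theorem twistedGramCoeff_odd_far_ge_diag_A (χ : DirichletCharacter ℂ q) (ha : 0 < a) {A : ℝ}
    (hPA : ∀ (s : Finset ℤ) (c : ℤ → ℂ),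
      -(A * ∑ n ∈ s, ‖c n‖ ^ 2) ≤ ∑ n ∈ s, ∑ m ∈ s, (conj (c n) * c m).re *
        ∑ k ∈ weilPrimeIndex a, (χ (k : ZMod q)).re * ((Λ k : ℝ) / Real.sqrt k) *
          (incrCoeff a (Real.log k) n m - if n = m then 2 else 0))
    {B : ℕ} (hB : 1 ≤ B) (N : ℕ) (z : ℕ → ℝ) :
    ∑ k ∈ Finset.Ico B N,
        ((reDigammaQuarter (freq a ((k : ℤ) + 1)) - Real.log π + Real.log q) / 2 - 1 / (8 * ((k : ℝ) + 1))
          - a * (1 + weilArchDensity (2 * a)) / (π ^ 2 * ((k : ℝ) + 1) ^ 2)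
          - Real.log ((((k : ℝ) + 1) + B) / B) / 4
          - a * (1 + weilArchDensity (2 * a)) / π ^ 2 * Real.sqrt (8 / B)
          - A / 2)
          * z k ^ 2
      ≤ ∑ k ∈ Finset.Ico B N, ∑ l ∈ Finset.Ico B N,
          z k * ((twistedGramCoeff χ a ((k : ℤ) + 1) ((l : ℤ) + 1) -
            twistedGramCoeff χ a ((k : ℤ) + 1) (-((l : ℤ) + 1))) / 2) * z l := by
  have hna := twistedGramCoeff_odd_nonarch_far_ge χ hPA B N z
  -- ARCH ⪰ diag(e⁻) with M₁ = B, modes n = k + 1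
  have harch := oddArch_far_ge_diag ha (M₁ := B) hB N (fun n ↦ z (n - 1))
  rw [← sum_Ico_succ_eq_sum_Ioc B N, ← sum_Ico_succ_eq_sum_Ioc B N] at harch
  simp only [Nat.add_sub_cancel] at harch
  have harch' : ∑ k ∈ Finset.Ico B N,
      ((reDigammaQuarter (freq a ((k : ℤ) + 1)) - Real.log π) / 2 - 1 / (8 * ((k : ℝ) + 1))
        - a * (1 + weilArchDensity (2 * a)) / (π ^ 2 * ((k : ℝ) + 1) ^ 2)
        - Real.log ((((k : ℝ) + 1) + B) / B) / 4
        - a * (1 + weilArchDensity (2 * a)) / π ^ 2 * Real.sqrt (8 / B)) * z k ^ 2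
      ≤ ∑ k ∈ Finset.Ico B N, ∑ l ∈ Finset.Ico B N,
          z k * ((archCoeff a ((k : ℤ) + 1) ((l : ℤ) + 1) - archCoeff a ((k : ℤ) + 1) (-((l : ℤ) + 1))) / 2)
            * z l := by
    refine le_of_eq_of_le ?_ (harch.trans (le_of_eq ?_))
    · refine Finset.sum_congr rfl fun k _ ↦ ?_
      push_cast
      ring
    · refine Finset.sum_congr rfl fun k _ ↦ ?_
      rw [← sum_Ico_succ_eq_sum_Ioc B N]
      refine Finset.sum_congr rfl fun l _ ↦ ?_
      simp only [Nat.add_sub_cancel]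
      push_cast
      ring
  have hlhs : ∑ k ∈ Finset.Ico B N,
      ((reDigammaQuarter (freq a ((k : ℤ) + 1)) - Real.log π + Real.log q) / 2 - 1 / (8 * ((k : ℝ) + 1))
        - a * (1 + weilArchDensity (2 * a)) / (π ^ 2 * ((k : ℝ) + 1) ^ 2)
        - Real.log ((((k : ℝ) + 1) + B) / B) / 4
        - a * (1 + weilArchDensity (2 * a)) / π ^ 2 * Real.sqrt (8 / B)
        - A / 2) * z k ^ 2
      = ((-A) / 2 * ∑ k ∈ Finset.Ico B N, z k ^ 2 + Real.log q / 2 * ∑ k ∈ Finset.Ico B N, z k ^ 2)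
        + ∑ k ∈ Finset.Ico B N,
          ((reDigammaQuarter (freq a ((k : ℤ) + 1)) - Real.log π) / 2 - 1 / (8 * ((k : ℝ) + 1))
            - a * (1 + weilArchDensity (2 * a)) / (π ^ 2 * ((k : ℝ) + 1) ^ 2)
            - Real.log ((((k : ℝ) + 1) + B) / B) / 4
            - a * (1 + weilArchDensity (2 * a)) / π ^ 2 * Real.sqrt (8 / B)) * z k ^ 2 := by
    rw [Finset.mul_sum, Finset.mul_sum, ← Finset.sum_add_distrib, ← Finset.sum_add_distrib]
    refine Finset.sum_congr rfl fun k _ ↦ by ring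
  rw [hlhs]
  linarith

/-- **L-C3a for a character, odd sector, arctan Hilbert weights, certified prime constant `A`** (the DATA
pipeline's default: bounded penalty `½(π/2 − arctan(√B/√(k+1))) ≤ π/4`). -/
theorem twistedGramCoeff_odd_far_ge_diag_atan_A (χ : DirichletCharacter ℂ q) (ha : 0 < a) {A : ℝ}
    (hPA : ∀ (s : Finset ℤ) (c : ℤ → ℂ),
      -(A * ∑ n ∈ s, ‖c n‖ ^ 2) ≤ ∑ n ∈ s, ∑ m ∈ s, (conj (c n) * c m).re *
        ∑ k ∈ weilPrimeIndex a, (χ (k : ZMod q)).re * ((Λ k : ℝ) / Real.sqrt k) *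
          (incrCoeff a (Real.log k) n m - if n = m then 2 else 0))
    {B : ℕ} (hB : 1 ≤ B) (N : ℕ) (z : ℕ → ℝ) :
    ∑ k ∈ Finset.Ico B N,
        ((reDigammaQuarter (freq a ((k : ℤ) + 1)) - Real.log π + Real.log q) / 2 - 1 / (8 * ((k : ℝ) + 1))
          - a * (1 + weilArchDensity (2 * a)) / (π ^ 2 * ((k : ℝ) + 1) ^ 2)
          - (π / 2 - Real.arctan (Real.sqrt B / Real.sqrt ((k : ℝ) + 1))) / 2
          - a * (1 + weilArchDensity (2 * a)) / π ^ 2 * Real.sqrt (8 / B)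
          - A / 2)
          * z k ^ 2
      ≤ ∑ k ∈ Finset.Ico B N, ∑ l ∈ Finset.Ico B N,
          z k * ((twistedGramCoeff χ a ((k : ℤ) + 1) ((l : ℤ) + 1) -
            twistedGramCoeff χ a ((k : ℤ) + 1) (-((l : ℤ) + 1))) / 2) * z l := by
  have hna := twistedGramCoeff_odd_nonarch_far_ge χ hPA B N z
  have harch := oddArch_far_ge_diag_atan ha (M₁ := B) hB N (fun n ↦ z (n - 1))
  rw [← sum_Ico_succ_eq_sum_Ioc B N, ← sum_Ico_succ_eq_sum_Ioc B N] at harch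
  simp only [Nat.add_sub_cancel] at harch
  have harch' : ∑ k ∈ Finset.Ico B N,
      ((reDigammaQuarter (freq a ((k : ℤ) + 1)) - Real.log π) / 2 - 1 / (8 * ((k : ℝ) + 1))
        - a * (1 + weilArchDensity (2 * a)) / (π ^ 2 * ((k : ℝ) + 1) ^ 2)
        - (π / 2 - Real.arctan (Real.sqrt B / Real.sqrt ((k : ℝ) + 1))) / 2
        - a * (1 + weilArchDensity (2 * a)) / π ^ 2 * Real.sqrt (8 / B)) * z k ^ 2
      ≤ ∑ k ∈ Finset.Ico B N, ∑ l ∈ Finset.Ico B N,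
          z k * ((archCoeff a ((k : ℤ) + 1) ((l : ℤ) + 1) - archCoeff a ((k : ℤ) + 1) (-((l : ℤ) + 1))) / 2)
            * z l := by
    refine le_of_eq_of_le ?_ (harch.trans (le_of_eq ?_))
    · refine Finset.sum_congr rfl fun k _ ↦ ?_
      push_cast
      ring
    · refine Finset.sum_congr rfl fun k _ ↦ ?_
      rw [← sum_Ico_succ_eq_sum_Ioc B N]
      refine Finset.sum_congr rfl fun l _ ↦ ?_
      simp only [Nat.add_sub_cancel]
      push_cast
      ring
  have hlhs : ∑ k ∈ Finset.Ico B N,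
      ((reDigammaQuarter (freq a ((k : ℤ) + 1)) - Real.log π + Real.log q) / 2 - 1 / (8 * ((k : ℝ) + 1))
        - a * (1 + weilArchDensity (2 * a)) / (π ^ 2 * ((k : ℝ) + 1) ^ 2)
        - (π / 2 - Real.arctan (Real.sqrt B / Real.sqrt ((k : ℝ) + 1))) / 2
        - a * (1 + weilArchDensity (2 * a)) / π ^ 2 * Real.sqrt (8 / B)
        - A / 2) * z k ^ 2
      = ((-A) / 2 * ∑ k ∈ Finset.Ico B N, z k ^ 2 + Real.log q / 2 * ∑ k ∈ Finset.Ico B N, z k ^ 2)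
        + ∑ k ∈ Finset.Ico B N,
          ((reDigammaQuarter (freq a ((k : ℤ) + 1)) - Real.log π) / 2 - 1 / (8 * ((k : ℝ) + 1))
            - a * (1 + weilArchDensity (2 * a)) / (π ^ 2 * ((k : ℝ) + 1) ^ 2)
            - (π / 2 - Real.arctan (Real.sqrt B / Real.sqrt ((k : ℝ) + 1))) / 2
            - a * (1 + weilArchDensity (2 * a)) / π ^ 2 * Real.sqrt (8 / B)) * z k ^ 2 := by
    rw [Finset.mul_sum, Finset.mul_sum, ← Finset.sum_add_distrib, ← Finset.sum_add_distrib]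
    refine Finset.sum_congr rfl fun k _ ↦ by ring
  rw [hlhs]
  linarith

end Far

/-! ## The bounds with the path-graph constant `A_op⁺(a)` -/

section Aop

/-- **L-C3a for a character, even sector, `A = A_op⁺(a)`** — hypothesis `hfar_e` of
`weilPositivityOnChar_of_formatC_certificates[_real]` for `G = twistedGramCoeff χ a`. -/
theorem twistedGramCoeff_even_far_ge_diag (χ : DirichletCharacter ℂ q) (ha : 0 < a) {B : ℕ} (hB : 2 ≤ B)
    (N : ℕ) (y : ℕ → ℝ) :
    ∑ n ∈ Finset.Ico B N,
        ((reDigammaQuarter (freq a n) - Real.log π + Real.log q) / 2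
          - a * (1 + weilArchDensity (2 * a)) / (π ^ 2 * n ^ 2)
          - 1 / (8 * n) - a * (1 + weilArchDensity (2 * a)) / π ^ 2 * Real.sqrt (8 / ((B - 1 : ℕ) : ℝ))
          - (∑ k ∈ weilPrimeIndex a, (Λ k : ℝ) / Real.sqrt k * (2 * Real.cos (π / (⌊2 * a / Real.log k⌋₊ + 2)))) / 2)
          * y n ^ 2
      ≤ ∑ n ∈ Finset.Ico B N, ∑ m ∈ Finset.Ico B N,
          y n * (if n = 0 then twistedGramCoeff χ a 0 m else if m = 0 then twistedGramCoeff χ a n 0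
            else (twistedGramCoeff χ a n m + twistedGramCoeff χ a n (-(m : ℤ))) / 2) * y m :=
  twistedGramCoeff_even_far_ge_diag_A χ ha (fun s c ↦ twistedPrime_form_ge_char χ ha s c) hB N y

/-- **L-C3a for a character, odd sector (log weight), `A = A_op⁺(a)`** — hypothesis `hfar_o`. -/
theorem twistedGramCoeff_odd_far_ge_diag (χ : DirichletCharacter ℂ q) (ha : 0 < a) {B : ℕ} (hB : 1 ≤ B)
    (N : ℕ) (z : ℕ → ℝ) :
    ∑ k ∈ Finset.Ico B N,
        ((reDigammaQuarter (freq a ((k : ℤ) + 1)) - Real.log π + Real.log q) / 2 - 1 / (8 * ((k : ℝ) + 1))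
          - a * (1 + weilArchDensity (2 * a)) / (π ^ 2 * ((k : ℝ) + 1) ^ 2)
          - Real.log ((((k : ℝ) + 1) + B) / B) / 4
          - a * (1 + weilArchDensity (2 * a)) / π ^ 2 * Real.sqrt (8 / B)
          - (∑ k ∈ weilPrimeIndex a, (Λ k : ℝ) / Real.sqrt k * (2 * Real.cos (π / (⌊2 * a / Real.log k⌋₊ + 2)))) / 2)
          * z k ^ 2
      ≤ ∑ k ∈ Finset.Ico B N, ∑ l ∈ Finset.Ico B N,
          z k * ((twistedGramCoeff χ a ((k : ℤ) + 1) ((l : ℤ) + 1) -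
            twistedGramCoeff χ a ((k : ℤ) + 1) (-((l : ℤ) + 1))) / 2) * z l :=
  twistedGramCoeff_odd_far_ge_diag_A χ ha (fun s c ↦ twistedPrime_form_ge_char χ ha s c) hB N z

/-- **L-C3a for a character, odd sector (arctan weight), `A = A_op⁺(a)`** — hypothesis `hfar_o`. -/
theorem twistedGramCoeff_odd_far_ge_diag_atan (χ : DirichletCharacter ℂ q) (ha : 0 < a) {B : ℕ} (hB : 1 ≤ B)
    (N : ℕ) (z : ℕ → ℝ) :
    ∑ k ∈ Finset.Ico B N,
        ((reDigammaQuarter (freq a ((k : ℤ) + 1)) - Real.log π + Real.log q) / 2 - 1 / (8 * ((k : ℝ) + 1))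
          - a * (1 + weilArchDensity (2 * a)) / (π ^ 2 * ((k : ℝ) + 1) ^ 2)
          - (π / 2 - Real.arctan (Real.sqrt B / Real.sqrt ((k : ℝ) + 1))) / 2
          - a * (1 + weilArchDensity (2 * a)) / π ^ 2 * Real.sqrt (8 / B)
          - (∑ k ∈ weilPrimeIndex a, (Λ k : ℝ) / Real.sqrt k * (2 * Real.cos (π / (⌊2 * a / Real.log k⌋₊ + 2)))) / 2)
          * z k ^ 2
      ≤ ∑ k ∈ Finset.Ico B N, ∑ l ∈ Finset.Ico B N,
          z k * ((twistedGramCoeff χ a ((k : ℤ) + 1) ((l : ℤ) + 1) -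
            twistedGramCoeff χ a ((k : ℤ) + 1) (-((l : ℤ) + 1))) / 2) * z l :=
  twistedGramCoeff_odd_far_ge_diag_atan_A χ ha (fun s c ↦ twistedPrime_form_ge_char χ ha s c) hB N z

end Aop

end Summit.Ventures.WeilGRH

end
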